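import Literature.AlgebraicGeometry.HodgeTheory.FiniteEtaleCoverOfFiniteIndexSmoothCurve
import Literature.AlgebraicGeometry.HodgeTheory.VanishingCohomologyNontrivialProofs
import Literature.AlgebraicGeometry.Motives.JacobianHomology
import Literature.AlgebraicGeometry.Motives.VarietiesProjectiveSpaceProofs
import Literature.AlgebraicGeometry.Motives.AbstractHodgeTate

/-!
# Route RigidUnwinding — crux `KummerEndgame` (stmt-HodgeConjecture-14766), line `birth`: STUB F `stub_finiteEtaleTrivialisation`

The registered stub F (`FiniteEtaleTrivialisation`) of the skeleton
`Cruxes/KummerEndgame/Lines/birth.lean`: for a smooth projective family `f : 𝒴 ⟶ U` over a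
non-empty open `U ⊂ ℙ¹_ℂ` and a FLAT family of operators `e_t` on `Hᵏ(Y_t(ℂ); ℂ)` such that every
class of `im e_s` has finitely many flat continuations along loops at `s` (finite monodromy of the
flat piece `L = im e`), there is a finite étale `g : U' ⟶ U`, `U'` irreducible, `g(ℂ)` onto, such that
on the base change `𝒴 ×_U U' ⟶ U'` every class `ε_{s'}^* α`, `α ∈ im e_{g(s')}`, is its own unique
continuation along every loop at `s'` (trivial monodromy).

## Proof (Voisin 2007, §3, proof of Prop. 0.7, for the finite-dimensional piece `L`)

1. `U` is a separated, irreducible, quasi-projective `ℂ`-scheme smooth of relative dimension `1`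
   (open in `ℙ¹`, `Motives.isSmoothProjective_projectiveSpace_holds`), so `Rᵏ f_* ℂ` is a local
   system on `U(ℂ)` (`isCohomologicallyLocallyTrivialOn_univ_of_isSmoothProjectiveFamily`).
2. At a base point `s₀`, `L_{s₀} = im e_{s₀}` is finite dimensional; each member of a finite spanning
   family has a finite monodromy orbit, hence is fixed by a finite-index subgroup of `π₁(U(ℂ), s₀)`
   (`exists_finiteIndex_of_finite_setOf_isContinuationAlong_of_isSmoothProjectiveFamily`); their
   intersection `H` has finite index and fixes `L_{s₀}` pointwise (transport is linear,
   `transportLinear`).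
3. Riemann's existence theorem for smooth curves — a THEOREM of the tree — gives the finite étale
   `g : U' ⟶ U` attached to the normal core of `H`, with `U'(ℂ)` path connected, a point `s₀'` over
   `s₀`, and all loops at `s₀'` mapping into `H` (`exists_finiteEtale_of_finiteIndex_smoothCurve`).
4. `U'` is smooth of relative dimension `1`, irreducible (`U'(ℂ)` connected), quasi-projective, `g`
   surjective (finite étale onto irreducible), `g(ℂ)` onto (`AlgPoints.map_surjective_of_surjective`)
   and a local homeomorphism.
5. FLATNESS of `e` makes transport map `L_s` into `L_t` (`transportFun_mem_range_of_flat`), so the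
   `H`-invariance at `s₀` conjugates along a path of `U'(ℂ)` from `s₀'` to any `s'`: every loop at
   `s'` maps to a loop acting trivially on `L_{g(s')}` (`transportFun_eq_self_of_conj`).
6. Hence `ε_{s'}^* α`, `α ∈ L_{g(s')}`, extends to a CONTINUOUS global section of the espace étalé of
   `Rᵏ f'_* ℂ` on `U'(ℂ)` (`exists_continuous_section_familyPullback`), and continuations along loops
   are unique and fix values of continuous sections (`isContinuationAlong_iff_transportFun_eq`,
   `transportFun_clsAt_loop_of_continuous`).

No definition, no named fact, no `sorry`; no Hodge theory is used. `HC_CM` plays no role here.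

References: [Voisin2007HodgeLoci] C. Voisin, Hodge loci and absolute Hodge classes, Compositio
Math. 143 (2007), §3, proof of Prop. 0.7; [VoisinHodgeI2002] §9.2.1, Thm. 9.3; [VoisinHodgeII2003]
Lemma 4.17; [SGA1] Exp. XII Thm. 5.1, Prop. 2.4, Prop. 3.1 (iii); [HatcherAT2002] §1.3 Prop. 1.34,
1.36.
-/

noncomputable section

-- mandated namespace of this single-conjunct summit (as in the sibling `Theorems/*` files)
set_option linter.dupNamespace false

open CategoryTheory AlgebraicGeometry TopologicalSpace
open Literature.AlgebraicGeometry.Motives Literature.AlgebraicGeometry.HodgeTheory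
open Literature.AlgebraicTopology.SingularHomology

namespace Summit.HodgeConjecture.HodgeConjecture.Theorems

/-! ### Transport and a flat family of operators -/

section Transport

variable {𝒴 U : SchemeOver ℂ} (f : 𝒴 ⟶ U) (k : ℕ)
  (hU : IsCohomologicallyLocallyTrivialOn f (Set.univ : Set (ComplexPoints U)))
  (e : ∀ t : ComplexPoints U, complexBetti (fiberOver f t) k →ₗ[ℂ] complexBetti (fiberOver f t) k)

/-- A path of the subspace `univ ⊆ U(ℂ)`, pushed to `U(ℂ)` and pulled back to `univ`, is itself.
[folklore] -/
theorem path_map_val_map_mk {a b : (Set.univ : Set (ComplexPoints U))} (γ : Path a b) :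
    (γ.map continuous_subtype_val).map (continuous_id.subtype_mk fun x ↦ Set.mem_univ x) = γ := by
  ext u
  rfl

/-- **Transport is a continuation**: `γ_* α` is a flat continuation of `α` along (the image in `U(ℂ)`
of) `γ`. [cite: VoisinHodgeI2002, §9.2.1] -/
theorem isContinuationAlong_transportFun {a b : (Set.univ : Set (ComplexPoints U))} (γ : Path a b)
    (α : complexBetti (fiberOver f a.1) k) :
    IsContinuationAlong (γ.map continuous_subtype_val) α (transportFun f k hU ⟦γ⟧ α) := by
  rw [isContinuationAlong_iff_transportFun_eq f k hU]
  exact congrArg (fun δ => transportFun f k hU (s := a) (t := b) ⟦δ⟧ α) (path_map_val_map_mk γ)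

/-- **A flat family of operators commutes with transport**: if `e` carries continuations to
continuations, then `γ_* (e_a α) = e_b (γ_* α)`. [cite: VoisinHodgeI2002, §9.2.1] -/
theorem transportFun_apply_of_flat
    (hflat : ∀ (s t : ComplexPoints U) (γ : Path s t) (α : complexBetti (fiberOver f s) k)
      (β : complexBetti (fiberOver f t) k),
      IsContinuationAlong γ α β → IsContinuationAlong γ (e s α) (e t β))
    {a b : (Set.univ : Set (ComplexPoints U))} (γ : Path a b) (α : complexBetti (fiberOver f a.1) k) :
    transportFun f k hU ⟦γ⟧ (e a.1 α) = e b.1 (transportFun f k hU ⟦γ⟧ α) := by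
  have h := (isContinuationAlong_iff_transportFun_eq f k hU _ _ _).1
    (hflat _ _ _ _ _ (isContinuationAlong_transportFun f k hU γ α))
  rwa [path_map_val_map_mk] at h

/-- **Transport preserves the flat piece `L = im e`**: `γ_* (im e_a) ⊆ im e_b`.
[cite: VoisinHodgeI2002, §9.2.1] -/
theorem transportFun_mem_range_of_flat
    (hflat : ∀ (s t : ComplexPoints U) (γ : Path s t) (α : complexBetti (fiberOver f s) k)
      (β : complexBetti (fiberOver f t) k),
      IsContinuationAlong γ α β → IsContinuationAlong γ (e s α) (e t β))
    {a b : (Set.univ : Set (ComplexPoints U))} (γ : Path a b) {u : complexBetti (fiberOver f a.1) k}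
    (hu : u ∈ LinearMap.range (e a.1)) : transportFun f k hU ⟦γ⟧ u ∈ LinearMap.range (e b.1) := by
  obtain ⟨w, rfl⟩ := hu
  exact ⟨transportFun f k hU ⟦γ⟧ w, (transportFun_apply_of_flat f k hU e hflat γ w).symm⟩

/-- **Conjugating pointwise invariance along a path.** If transport along the loop `ρ · γ · ρ⁻¹` at
`a` fixes `im e_a` pointwise, then transport along the loop `γ` at `b` fixes `im e_b` pointwise
(`e` flat, so `ρ⁻¹_*` carries `im e_b` into `im e_a`; transport is functorial and injective).
[cite: VoisinHodgeI2002, §9.2.1] -/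
theorem transportFun_eq_self_of_conj
    (hflat : ∀ (s t : ComplexPoints U) (γ : Path s t) (α : complexBetti (fiberOver f s) k)
      (β : complexBetti (fiberOver f t) k),
      IsContinuationAlong γ α β → IsContinuationAlong γ (e s α) (e t β))
    {a b : (Set.univ : Set (ComplexPoints U))} (ρ : Path a b) (γ : Path b b)
    (hfix : ∀ u ∈ LinearMap.range (e a.1), transportFun f k hU ⟦ρ.trans (γ.trans ρ.symm)⟧ u = u)
    {v : complexBetti (fiberOver f b.1) k} (hv : v ∈ LinearMap.range (e b.1)) :
    transportFun f k hU ⟦γ⟧ v = v := by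
  have hu : transportFun f k hU ⟦ρ.symm⟧ v ∈ LinearMap.range (e a.1) :=
    transportFun_mem_range_of_flat f k hU e hflat ρ.symm hv
  have h := hfix _ hu
  set qρ : Path.Homotopic.Quotient a b := ⟦ρ⟧ with hqρ
  set qγ : Path.Homotopic.Quotient b b := ⟦γ⟧ with hqγ
  change transportFun f k hU
      (Path.Homotopic.Quotient.trans qρ (Path.Homotopic.Quotient.trans qγ
        (Path.Homotopic.Quotient.symm qρ)))
      (transportFun f k hU (Path.Homotopic.Quotient.symm qρ) v) =
    transportFun f k hU (Path.Homotopic.Quotient.symm qρ) v at h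
  rw [transportFun_trans, transportFun_trans,
    ← transportFun_trans f k hU (Path.Homotopic.Quotient.symm qρ) qρ,
    Path.Homotopic.Quotient.symm_trans, transportFun_refl] at h
  -- cancel the transport along `ρ⁻¹` (transport back along `ρ`)
  have key : ∀ x : complexBetti (fiberOver f b.1) k,
      transportFun f k hU qρ (transportFun f k hU (Path.Homotopic.Quotient.symm qρ) x) = x := by
    intro x
    rw [← transportFun_trans, Path.Homotopic.Quotient.symm_trans, transportFun_refl]
  calc transportFun f k hU qγ v
      = transportFun f k hU qρ (transportFun f k hU (Path.Homotopic.Quotient.symm qρ)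
          (transportFun f k hU qγ v)) := (key _).symm
    _ = transportFun f k hU qρ (transportFun f k hU (Path.Homotopic.Quotient.symm qρ) v) := by
          rw [h]
    _ = v := key v

/-- Transport along a loop fixing a family of classes fixes their span (transport is linear,
`transportLinear`). [cite: VoisinHodgeI2002, §9.2.1] -/
theorem transportFun_eq_self_of_mem_span {a : (Set.univ : Set (ComplexPoints U))}
    (γ : Path.Homotopic.Quotient a a) {ι : Type*} (b : ι → complexBetti (fiberOver f a.1) k)
    (hb : ∀ i, transportFun f k hU γ (b i) = b i) {u : complexBetti (fiberOver f a.1) k}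
    (hu : u ∈ Submodule.span ℂ (Set.range b)) : transportFun f k hU γ u = u := by
  have hle : Submodule.span ℂ (Set.range b) ≤
      LinearMap.eqLocus (transportLinear f k hU γ) LinearMap.id := by
    rw [Submodule.span_le]
    rintro _ ⟨i, rfl⟩
    change transportLinear f k hU γ (b i) = b i
    rw [transportLinear_apply]
    exact hb i
  have h := hle hu
  change transportLinear f k hU γ u = u at h
  rwa [transportLinear_apply] at h

end Transport

/-! ### The base: opens of `ℙ¹` -/

section Base

variable {U : SchemeOver ℂ}

/-- An open subscheme of `ℙ¹_ℂ` is smooth of relative dimension `1` over `ℂ`. [folklore] -/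
theorem smoothOfRelativeDimension_one_of_isOpenImmersion_projectiveLine
    (j : U ⟶ projectiveSpace 1 ℂ) [IsOpenImmersion j.left] : SmoothOfRelativeDimension 1 U.hom := by
  haveI := (isSmoothProjective_projectiveSpace_holds ℂ 1).smoothOfRelativeDimension
  rw [← Over.w j]
  exact inferInstanceAs (SmoothOfRelativeDimension (0 + 1) (j.left ≫ (projectiveSpace 1 ℂ).hom))

/-- An open subscheme of `ℙ¹_ℂ` is separated over `ℂ`. [folklore] -/
theorem isSeparated_of_isOpenImmersion_projectiveLine
    (j : U ⟶ projectiveSpace 1 ℂ) [IsOpenImmersion j.left] : IsSeparated U.hom := by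
  haveI : IsProper (projectiveSpace 1 ℂ).hom :=
    (isSmoothProjective_projectiveSpace_holds ℂ 1).isProjectiveOver.isProper
  rw [← Over.w j]
  infer_instance

/-- A non-empty open subscheme of `ℙ¹_ℂ` is irreducible. [folklore] -/
theorem irreducibleSpace_of_isOpenImmersion_projectiveLine
    (j : U ⟶ projectiveSpace 1 ℂ) [IsOpenImmersion j.left] [Nonempty U.left] :
    IrreducibleSpace U.left := by
  haveI := (isSmoothProjective_projectiveSpace_holds ℂ 1).irreducibleSpace
  exact j.left.isOpenEmbedding.irreducibleSpace

/-- An open subscheme of `ℙ¹_ℂ` is quasi-projective over `ℂ`. [folklore] -/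
theorem isQuasiProjectiveOver_of_isOpenImmersion_projectiveLine
    (j : U ⟶ projectiveSpace 1 ℂ) [IsOpenImmersion j.left] : IsQuasiProjectiveOver U :=
  ⟨projectiveSpace 1 ℂ, j, (isSmoothProjective_projectiveSpace_holds ℂ 1).isProjectiveOver,
    inferInstance⟩

end Base

/-! ### Stub F -/

/-- **STUB F of crux `KummerEndgame` (stmt-HodgeConjecture-14766), line `birth`, in its registered
shape** (`FiniteEtaleTrivialisation`): finite monodromy of the flat piece `L = im e` of `Rᵏ f_* ℂ`
over a non-empty open `U ⊂ ℙ¹_ℂ` is killed by a finite étale cover `g : U' ⟶ U` with `U'`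
irreducible and `g(ℂ)` onto — on `𝒴 ×_U U' ⟶ U'` every `ε_{s'}^* α`, `α ∈ im e_{g(s')}`, is its own
unique continuation along every loop at `s'`. Proof: module docstring (Riemann existence for smooth
curves is the tree's theorem `FundamentalGroup.riemannExistence_smoothCurve`, through
`exists_finiteEtale_of_finiteIndex_smoothCurve`). [cite: Voisin2007HodgeLoci, §3, proof of Prop. 0.7]
[cite: SGA1, Exp. XII Thm. 5.1 (p. 333)] [cite: HatcherAT2002, §1.3 Prop. 1.36 and Prop. 1.34]
[cite: VoisinHodgeII2003, Lemma 4.17] -/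
theorem stub_finiteEtaleTrivialisation :
    ∀ (U 𝒴 : SchemeOver ℂ) (j : U ⟶ projectiveSpace 1 ℂ) (f : 𝒴 ⟶ U) (d k : ℕ) (e : ∀ t : ComplexPoints U, complexBetti (fiberOver f t) k →ₗ[ℂ] complexBetti (fiberOver f t) k), AlgebraicGeometry.IsOpenImmersion j.left → Nonempty (ComplexPoints U) → IsSmoothProjectiveFamily f d → (∀ (s t : ComplexPoints U) (γ : Path s t) (α : complexBetti (fiberOver f s) k) (β : complexBetti (fiberOver f t) k), IsContinuationAlong γ α β → IsContinuationAlong γ (e s α) (e t β)) → (∀ (s : ComplexPoints U) (α : complexBetti (fiberOver f s) k), α ∈ LinearMap.range (e s) → Set.Finite {β : complexBetti (fiberOver f s) k | ∃ γ : Path s s, IsContinuationAlong γ α β}) → ∃ (U' : SchemeOver ℂ) (g : U' ⟶ U), AlgebraicGeometry.IsFinite g.left ∧ AlgebraicGeometry.Etale g.left ∧ IrreducibleSpace U'.left ∧ Function.Surjective (AlgPoints.map g : ComplexPoints U' → ComplexPoints U) ∧ ∀ (s' : ComplexPoints U') (γ' : Path s' s') (α : complexBetti (fiberOver f (AlgPoints.map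 g s')) k) (β' : complexBetti (fiberOver (familyPullback.snd f g) s') k), α ∈ LinearMap.range (e (AlgPoints.map g s')) → IsContinuationAlong γ' (complexBetti.map (fiberOverFamilyPullbackIso f g s').hom k α) β' → β' = complexBetti.map (fiberOverFamilyPullbackIso f g s').hom k α := by
  intro U 𝒴 j f d k e hj hne hf hflat hfin
  -- Step 1: the base `U ⊂ ℙ¹` and the local system `Rᵏ f_* ℂ` on `U(ℂ)`
  obtain ⟨s₀⟩ := hne
  haveI := hj
  haveI : Nonempty U.left := ⟨s₀.pt⟩
  haveI : SmoothOfRelativeDimension 1 U.hom :=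
    smoothOfRelativeDimension_one_of_isOpenImmersion_projectiveLine j
  haveI : Smooth U.hom := SmoothOfRelativeDimension.smooth 1 U.hom
  haveI : LocallyOfFiniteType U.hom := inferInstance
  haveI : IrreducibleSpace U.left := irreducibleSpace_of_isOpenImmersion_projectiveLine j
  have hUqp : IsQuasiProjectiveOver U := isQuasiProjectiveOver_of_isOpenImmersion_projectiveLine j
  haveI : IsSeparated U.hom := isSeparated_of_isOpenImmersion_projectiveLine j
  have hU := isCohomologicallyLocallyTrivialOn_univ_of_isSmoothProjectiveFamily f 1 hf hUqp
  -- Step 2: a finite-index subgroup of `π₁(U(ℂ), s₀)` fixing `L_{s₀} = im e_{s₀}` pointwise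
  haveI : Module.Finite ℂ (complexBetti (fiberOver f s₀) k) :=
    finite_complexBetti (hf.isSmoothProjective s₀) k
  obtain ⟨m, b, hb⟩ := Module.Finite.exists_fin (R := ℂ) (M := ↥(LinearMap.range (e s₀)))
  have hH : ∀ i : Fin m, ∃ H : Subgroup (FundamentalGroup (Set.univ : Set (ComplexPoints U))
      ⟨s₀, Set.mem_univ s₀⟩), H.FiniteIndex ∧
      ∀ γ ∈ H, transportFun f k hU (FundamentalGroup.toPath γ) (b i : complexBetti (fiberOver f s₀) k) =
        (b i : complexBetti (fiberOver f s₀) k) :=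
    fun i ↦ exists_finiteIndex_of_finite_setOf_isContinuationAlong_of_isSmoothProjectiveFamily f k 1 hf
      hUqp s₀ _ (hfin s₀ _ (b i).2)
  choose H hHfi hHfix using hH
  haveI : (⨅ i, H i).FiniteIndex := Subgroup.finiteIndex_iInf hHfi
  have hLfix : ∀ γ ∈ ⨅ i, H i, ∀ u ∈ LinearMap.range (e s₀),
      transportFun f k hU (FundamentalGroup.toPath γ) u = u := by
    intro γ hγ u hu
    refine transportFun_eq_self_of_mem_span f k hU (FundamentalGroup.toPath γ)
      (fun i ↦ (b i : complexBetti (fiberOver f s₀) k)) (fun i ↦ hHfix i γ (iInf_le H i hγ)) ?_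
    -- `u ∈ span (b i)`: the `b i` span `L_{s₀}`
    have hu' : (⟨u, hu⟩ : ↥(LinearMap.range (e s₀))) ∈ Submodule.span ℂ (Set.range b) := by
      rw [hb]; exact Submodule.mem_top
    have himg := Submodule.apply_mem_span_image_of_mem_span (LinearMap.range (e s₀)).subtype hu'
    rw [← Set.range_comp] at himg
    exact himg
  -- Step 3: the finite étale cover attached to `⨅ H i` (Riemann existence for smooth curves)
  obtain ⟨U', g, s₀', hs, hgfin, hget, hU'pc, hloops⟩ :=
    exists_finiteEtale_of_finiteIndex_smoothCurve U s₀ (⨅ i, H i)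
  subst hs
  haveI := hgfin
  haveI := hget
  haveI := hU'pc
  -- Step 4: `U'` smooth of relative dimension `1`, irreducible, quasi-projective; `g` onto, `g(ℂ)` a
  -- local homeomorphism onto; the local system upstairs
  haveI hg0 : SmoothOfRelativeDimension 0 g.left := inferInstance
  haveI : Smooth g.left := SmoothOfRelativeDimension.smooth 0 _
  haveI hU'd : SmoothOfRelativeDimension 1 U'.hom := by
    have h : SmoothOfRelativeDimension (0 + 1) (g.left ≫ U.hom) := inferInstance
    rw [Over.w] at h
    simpa using h
  haveI : Smooth U'.hom := SmoothOfRelativeDimension.smooth 1 _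
  haveI : LocallyOfFiniteType U'.hom := inferInstance
  haveI : ConnectedSpace (ComplexPoints U') := inferInstance
  haveI hU'irr : IrreducibleSpace U'.left := irreducibleSpace_left_of_connectedSpace_complexPoints
  haveI : Nonempty U'.left := inferInstance
  haveI hgsurj : Surjective g.left := surjective_of_isFinite_of_etale_of_irreducible g.left
  haveI : IsReduced U.left := isReduced_of_smooth_over_field U.hom
  haveI : IsReduced U'.left := isReduced_of_smooth_over_field U'.hom
  haveI : IsIntegral U.left := isIntegral_of_irreducibleSpace_of_isReduced U.left
  haveI : IsIntegral U'.left := isIntegral_of_irreducibleSpace_of_isReduced U'.left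
  have hU'qp : IsQuasiProjectiveOver U' := isQuasiProjectiveOver_of_isFinite_of_surjective g hUqp
  letI := ComplexPoints.chartedSpace U' 1
  haveI : LocallyPathConnectedSpace (ComplexPoints U') :=
    ChartedSpace.locallyPathConnectedSpace (EuclideanSpace ℝ (Fin (2 * 1))) _
  have hgloc : IsLocalHomeomorph (AlgPoints.map g : ComplexPoints U' → ComplexPoints U) :=
    ComplexPoints.isLocalHomeomorph_map 1 _
  have hgC : Function.Surjective (AlgPoints.map g : ComplexPoints U' → ComplexPoints U) :=
    AlgPoints.map_surjective_of_surjective g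
  set f' := familyPullback.snd f g with hf'
  have hfam' : IsSmoothProjectiveFamily f' d := hf.familyPullback_snd g
  have hU' := isCohomologicallyLocallyTrivialOn_univ_of_isSmoothProjectiveFamily f' 1 hfam' hU'qp
  refine ⟨U', g, hgfin, hget, hU'irr, hgC, fun s' γ' α β' hα hcont ↦ ?_⟩
  -- Step 5: every loop at `s'` acts trivially on `L_{g s'}` downstairs (conjugate to `s₀'`)
  have hinv : ∀ δ' : Path (⟨s', Set.mem_univ s'⟩ : (Set.univ : Set (ComplexPoints U')))
      ⟨s', Set.mem_univ s'⟩,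
      transportFun f k hU (s := ⟨AlgPoints.map g s', Set.mem_univ _⟩)
        (t := ⟨AlgPoints.map g s', Set.mem_univ _⟩)
        ⟦δ'.map ((((AlgPoints.continuous_map g).comp continuous_subtype_val)).subtype_mk
          fun _ ↦ Set.mem_univ _)⟧ α = α := by
    intro δ'
    -- a path from the base point `s₀'` to `s'` upstairs, and its image downstairs
    have hG : Continuous fun x : (Set.univ : Set (ComplexPoints U')) ↦
        (⟨AlgPoints.map g x.1, Set.mem_univ _⟩ : (Set.univ : Set (ComplexPoints U))) :=
      (((AlgPoints.continuous_map g).comp continuous_subtype_val)).subtype_mk fun _ ↦ Set.mem_univ _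
    haveI : PathConnectedSpace (Set.univ : Set (ComplexPoints U')) :=
      isPathConnected_iff_pathConnectedSpace.mp isPathConnected_univ
    let ρ' : Path (⟨s₀', Set.mem_univ s₀'⟩ : (Set.univ : Set (ComplexPoints U'))) ⟨s', Set.mem_univ s'⟩ :=
      PathConnectedSpace.somePath _ _
    refine transportFun_eq_self_of_conj f k hU e hflat (ρ'.map hG) (δ'.map hG) (fun u hu ↦ ?_) hα
    -- the conjugated loop at `s₀'` maps into `⨅ H i`
    have hmem := hloops (ρ'.trans (δ'.trans ρ'.symm))
    have hpath : (ρ'.trans (δ'.trans ρ'.symm)).map hG =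
        (ρ'.map hG).trans ((δ'.map hG).trans (ρ'.map hG).symm) := by
      rw [Path.map_trans, Path.map_trans, Path.map_symm]
    have h := hLfix _ hmem u hu
    change transportFun f k hU ⟦(ρ'.trans (δ'.trans ρ'.symm)).map hG⟧ u = u at h
    rwa [hpath] at h
  -- Step 6: a continuous global section upstairs through `(s', ε^* α)`; uniqueness of continuation
  obtain ⟨σ', hσ'c, hσ'pt, hσ'₀⟩ := exists_continuous_section_familyPullback f g k hgloc hU hU' s'
    (complexBetti.map (fiberOverFamilyPullbackIso f g s').hom k α)
    (FiberClass.cls_baseChange_map_hom f g k s' α) hinv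
  have h1 := (isContinuationAlong_iff_transportFun_eq f' k hU' γ' _ β').1 hcont
  have h2 := transportFun_clsAt_loop_of_continuous f' k hU' hσ'c hσ'pt (s := ⟨s', Set.mem_univ s'⟩)
    ⟦γ'.map (continuous_id.subtype_mk fun x ↦ Set.mem_univ x)⟧
  have h3 : (σ' s').clsAt (hσ'pt s') = complexBetti.map (fiberOverFamilyPullbackIso f g s').hom k α :=
    (FiberClass.clsAt_eq_iff _ _ _).2 hσ'₀
  rw [h3] at h2
  exact h1.symm.trans h2

end Summit.HodgeConjecture.HodgeConjecture.Theorems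

end
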